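import Literature.MathematicalPhysics.QuantumFieldTheory.Balaban1983to89.B4Cor23RegularWindow
import Literature.MathematicalPhysics.QuantumFieldTheory.Balaban1983to89.B2Sect2Statements
import Literature.MathematicalPhysics.QuantumFieldTheory.Balaban1983to89.B2StepK

/-!
# `Balaban1983to89.B2Ineq2109RegularField` — [Balaban1982Higgs2] **(2.108)–(2.109)** p. 580: the operator `H_k` of the
# *«difference between the quadratic forms»* and the FIRST inequality of (2.109), `|h_k(x,x′)| ≤ O(1)e^{−δ₁r(Lᵏε)}e^{−δ₀|x−x′|}`,
# PROVED for the CONCRETE covariant unit-lattice operators `Δ^{(k)}(Ω, B̃)` of I (2.21) / B4 (1.14) at a REGULAR vector field,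
# by the printed route *«using Proposition I.2.2»* (I (2.27)/(2.29) at `A ≠ 0` = `B4Cor23RegularWindow.prop22Small_regularPairW`)

statement-level skeleton of published theorems with citation tags; proofs where landed; nothing here is a claim about the Yang–Mills mass gap

PDF held: `paper:balaban1982-cmp86-higgs23-ii` (T. Bałaban, *(Higgs)₂,₃ quantum fields in a finite volume. II. An upper
bound*, Commun. Math. Phys. **86** (1982) 555–594, doi 10.1007/bf01214890 [Balaban1982Higgs2]; journal page = PDF page + 554);
pp. 558, 564–566, 575–580 [PDF 4, 10–12, 21–26] READ AS IMAGES on the ×2 renders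
`run/shared/lean/pub/pub-balaban/b2b-balaban-ref1/pages/1982-cmp86-higgs23-II/1982-cmp86-higgs23-II-p0NN-x2.png`; part I =
[Balaban1982Higgs1] Prop. 2.2 (2.27)–(2.29) p. 611 as typed by pv07 (`B1.Prop22Small`) and PROVED at `A ≠ 0` by p17
(`B1Prop22RegularField`, `B4Cor23RegularWindow`); B4 = [Balaban1983RegularityDecay] (1.14) p. 573.

CITATION HEADER (lean-in-tree rule).  Cell `lit-balaban` (HOME `run/shared/lean/pub/lit-balaban/`), Phase-2 proof seat **p23**
gen 7 (unit `lit-balaban-p23-g7`); SKELETON row **B2.Eq2.109** ((2.108)–(2.109) p. 580; decl of record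
`…B2Sect2Statements.Ineq2109` = the FIRST inequality, r02, UNCHANGED; r14's twin predicate `…B2StepK.KernelBound2109` and the
second inequality `…B2StepK.kernelBound2109_pow_of_printed` (p240722), consumed BY NAME); status before this file: «typed —
PARTIAL: the first inequality (the kernel bound from B1 Prop 2.2) typed only»; kind «model instance on the concrete regular-field
carriers» (PHASE2-TARGETS §G.1); fold owner r02, second reader r14, referee ref-4.  USED BY NAME, files untouched:
p17's `B1Prop22RegularFieldAlg.deltaK` (`Δ^{(k)}(Ω,A) = a_kI − a_k²Q_k(A)G_k(Ω,A)Q_k^*(A)` on the unit sites of a region of the b04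
lineage, transporters along the block contours), `B1Prop22RegularField.{regDict, Sph, Inst.udist_eq, Inst.distOc}` (the
dictionary of `B1.Prop22Small`: `|Δ^{(k)}(Ω,A;y,y′)|` = block operator norm, `|y − y′|` = sup-distance of unit labels,
`dist(y,Ω^{(k)c})` = η-distance of the base corner of `B(y)` to the fine points of `Ω₀ ∖ Ω`), `B4Cor23RegularWindow.{RegularPairInstanceW,
prop22Small_regularPairW}` (Prop. I.2.2 at `A ≠ 0`, ONE `(δ₀, c₀, e₁)` for all meshes, nested region pairs, regular fields and
all `a_k ∈ [a₋, a₊]`), b04's `B4Lower18.{fineDom, IsBlockUnion, edistR}`, `B4Cor23ZeroDelta.{setDist, outR}`, `B4TwoRegion120.incl`.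

WHAT IS PRINTED (p. 580 [PDF 26], verbatim, render read as image).  *"Now we will transform the basic quadratic form in the
scalar fields and next we will do a translation in the field φ. We will localize this form in the set Λ₆^{(k−1)′}∩Λ₃^{(k)c},
Λ₃^{(k)}, and we will change the operators of the forms using Proposition I.2.2 and the restrictions on the fields ψ, φ. We
have ½aL^{d−2}Σ_{y∈T₁^{(k)′}}|ψ(y) − (Q(θ_kB̃)φ)(y)|² + ½⟨(Λ₆^{(k−1)′}∩Λ₃^{(k)c})φ, Δ^{(k)}(B^k(Λ₂^{(k−1)′}∩Λ₅^{(k)c}), B̃)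
(Λ₆^{(k−1)′}∩Λ₃^{(k)c})φ⟩ + ⟨(Λ₆^{(k−1)′}∩Λ₃^{(k)c})φ, Δ^{(k)}(B^k(Λ₂^{(k−1)′}∩Λ₅^{(k)c}), B̃)(Λ₃^{(k)}∩Λ₄^{(k)c})φ⟩ + ⟨Λ₃^{(k)}φ,
Δ^{(k)}(B^k(Λ₂^{(k)}), B^{(k+1),η})Λ₃^{(k)}φ⟩ + O((Lᵏε)^κ)|Λ₃^{(k)}|.  (2.108)  More exactly the difference between the quadratic
forms is a quadratic form ½⟨Λ₆^{(k−1)′}φ, H_kΛ₆^{(k−1)′}φ⟩ and for the matrix elements h_k(x, x′) of the operator H_k of this form,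
the following inequality holds |h_k(x, x′)| ≦ O(1)exp(−δ₁r(Lᵏε))exp(−δ₀|x − x′|) ≦ O((Lᵏε)^κ)exp(−δ₀|x − x′|)  (2.109)  for x,
x′ ∈ Λ₆^{(k−1)′} and arbitrary κ."*  The basic quadratic form in the scalar field before the localization is `½⟨Λ₆^{(k−1)′}φ,
Δ^{(k)}(B^k(Λ₂^{(k−1)′}), B̃)Λ₆^{(k−1)′}φ⟩` ((2.87) p. 575 and p. 579: *"thus we have the propagator G_k(B^k(Λ₀^{(k)}), B̃) … this
configuration satisfies the regularity assumption of Proposition I.2.1 on the basis of the estimate (2.98)"*; the field `B̃` is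
the «large» part of (2.93), p. 576: *"Let us consider the remaining part of the expression (2.93) and let us denote it by B̃"*,
which on `B^k(Λ₂^{(k)})` EQUALS `θ_{k+1}B^{(k+1),η} = B^{(k+1),η}` because `θ_{k+1} ≡ 1` there — so the fourth term of (2.108) is a
change of DOMAIN only).  The sets: (2.7)–(2.8) p. 558, *"Λ_{i+1}^c is the sum of all large blocks of T₁ with distances from the
set Λ_i^c less or equal r(ε)"*, at scale `Lᵏε` (p. 566).  Part I, p. 611: *"|Δ^{(k)}(Ω,A;x,x′)| ≤ c₀exp(−δ₀|x−x′|) (2.27) …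
|δΔ^{(k)}(Ω,Ω₀,A;x,x′)| ≤ c₀ exp(−δ₀(|x−x′| + dist(x,Ω^{(k)c}) + dist(x′,Ω^{(k)c}))) (2.29)"*.

THE ARGUMENT (the print gives the route, *«using Proposition I.2.2»*; the bookkeeping is the evident one).  Write `Ω = B^k(Λ₂^{(k−1)′})`,
`Ω₁ = B^k(Λ₂^{(k−1)′}∩Λ₅^{(k)c})`, `Ω₂ = B^k(Λ₂^{(k)})`, `P = Λ₆^{(k−1)′}∩Λ₃^{(k)c}`.  `H_k` = `Λ₆′Δ^{(k)}(Ω,B̃)Λ₆′` minus the three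
localized operators of (2.108) (the cross term symmetrized).  Block by block: on `P × P`, `P × (Λ₃∖Λ₄)`, `(Λ₃∖Λ₄) × P` the
entry is `−δΔ^{(k)}(Ω₁,Ω,B̃)(x,x′)`, and both points are `≥ r` away from `Λ₅^{(k)} = Ω ∖ Ω₁` ((2.8): `dist(Λ₄ᶜ, Λ₅) > r`), so (I.2.29)
gives `c₀e^{−δ₀|x−x′|}e^{−2δ₀(r−1)}`; on `P × Λ₄`, `Λ₄ × P` nothing is subtracted and `|x − x′| ≥ r` ((2.8): `dist(Λ₃ᶜ, Λ₄) > r`), so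
(I.2.27) gives `c₀e^{−δ₀|x−x′|} ≤ c₀e^{−δ₀r/2}e^{−δ₀|x−x′|/2}`; on `Λ₃ × Λ₃` the entry is `−δΔ^{(k)}(Ω₂,Ω,B̃)(x,x′)` with both points
`≥ r` from `Ω ∖ Ω₂` (`dist(Λ₃^{(k)}, Λ₂^{(k)c}) > r`).  Hence (2.109)₁ with `O(1) = c₀e^{2δ₀}`, `δ₀/2`, `δ₁ = δ₀/2`; the constants of
Prop. I.2.2 are uniform over the whole window family, so `O(1), δ₀, δ₁` are independent of `k`, `ε`, the sequence and the fields.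

DICTIONARY (print ↦ Lean; b04 lattice units `η = 1/n`, `n = Lᵏ`, space-time dimension `d+1`, colour space `R^N = ι → ℝ`).
`Inst`: `Ωc` ↤ the unit labels `Λ₂^{(k−1)′}` of `Ω`; `L6 ⊇ L3 ⊇ L4 ⊇ L5` ↤ `Λ₆^{(k−1)′} ⊇ Λ₃^{(k)} ⊇ Λ₄^{(k)} ⊇ Λ₅^{(k)}`; `L2k` ↤
`Λ₂^{(k)}` (`L3 ⊆ L2k ⊆ Ωc`); `Ac` ↤ `B̃`; `e` ↤ `e(Lᵏε)`; `ak ∈ [a₋,a₊]` ↤ `a_k`; `m2` ↤ the mass of `Δ^{(k)}`; `r` ↤ `r(Lᵏε)`.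
`opΩ/op1/op2` ↤ `Δ^{(k)}(Ω,B̃)`, `Δ^{(k)}(Ω₁,B̃)`, `Δ^{(k)}(Ω₂,B^{(k+1),η})` (= p17's `deltaK` on `Ωc`, `Ωc ∖ L5`, `L2k`); `X = ↥L6 × ι` ↤
`Λ₆^{(k−1)′} × {1,…,N}`; `MΩ`, `MPP`, `MP34`, `M34P`, `M33` ↤ the matrices on `X` of the full form and of the three localized forms;
**`Hk := MΩ − MPP − MP34 − M34P − M33`** ↤ `H_k`; `hk p q` ↤ `h_k(x,x′)` (matrix elements, `p = (x,j)`, `q = (x′,j′)`);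
`supNorm (x − x′)` ↤ `|x − x′|` (sup-distance of unit labels = `Inst.udist_eq`).  `Adm c β M e₁ i` ↤ the standing context:
regularity (I.2.23) of `B̃` on `Ω` in b04's form (1.7) with constants `c, β`; `Ω, Ω₁, Ω₂` unions of `M`-blocks; `0 < e ≤ e₁`;
`r ≥ 0`; the (2.8) separations `sep45/sep34/sep2k`.

WHAT IS KERNEL-CHECKED (zero `sorry`, no new `def … : Prop` fact; axioms standard).
 §1 `abs_entry_le_iSup`, `abs_entry_sub_le_iSup`: matrix elements ≤ the block operator norms of `regDict` (`|v_j| ≤ 1` on the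
    unit sphere, `BddAbove` by `Σ|K|`), so p17's (2.27)/(2.29) give entry bounds `abs_deltaK_entry_le`, `abs_deltaK_entry_sub_le`.
 §2 `supNorm_corner_sub_ge` (`n|y − blk z|_∞ − (n−1) ≤ |n·y − z|_∞`), `le_setDist`, **`le_distOc`** (`dist(y,Ω^{(k)c}) ≥ R − 1`
    from unit-label separation `≥ R`), `deltaK_entry_of_eq` (void localizations).
 §3 `Inst`, `pairW` (the three region pairs `Ω ⊆ Ω`, `Ω₁ ⊆ Ω`, `Ω₂ ⊆ Ω` in p17's window family), the operators and matrices,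
    **`Hk`**, **`eq2108_split`** (the splitting `⟨φ,MΩφ⟩ = ⟨φ,MPPφ⟩ + (⟨φ,MP34φ⟩ + ⟨φ,M34Pφ⟩) + ⟨φ,M33φ⟩ + ⟨φ,H_kφ⟩`, exact), the
    block formulas `hk_PP/hk_P34/hk_P4/hk_34P/hk_4P/hk_33`, `DΩ_sub_D1/DΩ_sub_D2/DΩ_eq` (the blocks ARE `−δΔ(Ω₁,Ω)`, `−δΔ(Ω₂,Ω)`,
    `Δ(Ω)` entries of p17's pairs).
 §4 `Adm`, `damped_le`, `far_le`, **`Inst.abs_hk_le`** = (2.109)₁ pointwise with explicit `(e₁, C, δ₀, δ₁)`.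
 §5 **`ineq2109_regularField : ∃ e₁ > 0, B2Sect2Statements.Ineq2109 (admissible family) hk dist r`** (+ `_rot` for the rotation
    flow `N = 2`, `_exp` for `U = e^{tq}`, any antisymmetric `q`), `kernelBound2109_regularField` (r14's twin), and
    **`ineq2109_pow_regularField`** = the SECOND inequality *"≤ O((Lᵏε)^κ)e^{−δ₀|x−x′|}, κ arbitrary"* for `r = r(Lᵏε)` in the
    printed ranges, by r14's `kernelBound2109_pow_of_printed`.

HONEST SCOPE.  (a) MODEL INSTANCE: the operators are the concrete `Δ^{(k)}(Ω,A)` of the b04/p17 lineage (finite nested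
unions of unit blocks in `ℤ^{d+1}` at mesh `1/n`, transporters along block contours, colour flow any orthogonal one-parameter
group with a Lipschitz bound) — not a torus; `B̃` is ANY field regular on `Ω` in the sense (I.2.23)/(1.7): that the actual `B̃` of
(2.93) is regular is the printed (2.94)–(2.98), NOT re-derived here; that `B̃ = B^{(k+1),η}` on `B^k(Λ₂^{(k)})` is read off (2.93)
(`θ_{k+1} ≡ 1` there) and is the reason `op2` carries the same field.  (b) The (2.8) separations and «unions of big blocks» enter
as the hypotheses `Adm.sep45/sep34/sep2k/blkΩ/blk1/blk2` (consequences of the construction (2.7)–(2.8), cf. r14's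
`B2LargeField.lambdaCompl_far`); `|x − x′|`, `dist(·, ·)` are sup-distances of unit labels (b04's reading; allowance `−1` for the
base-corner convention inside `le_distOc`).  (c) Proved: the kernel statement (2.109) (both inequalities) and the exact splitting
behind (2.108); NOT proved here: the size `O((Lᵏε)^κ)|Λ₃^{(k)}|` of `½⟨Λ₆′φ,H_kΛ₆′φ⟩` under the restrictions on `φ` (it needs the
`x`-dependent damping and lattice sums; companion file), nor anything about `ψ`, the translation (2.110) or the functional
integral.  (d) `e₁` («e(Lᵏε) sufficiently small») and `(C, δ₀, δ₁)` are those of p17's Prop. I.2.2 (`C = c₀e^{2δ₀}`, rates halved),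
uniform in everything else; unoptimised.  (e) Value = kernel certificate of a lemma-level kernel bound in the lineage's typed
setting; NOT summit progress.
-/

namespace Literature.MathematicalPhysics.QuantumFieldTheory.Balaban1983to89.B2Ineq2109RegularField

open Finset Matrix
open Literature.MathematicalPhysics.QuantumFieldTheory.Balaban1983to89
open Literature.MathematicalPhysics.QuantumFieldTheory.Balaban1983to89.B4GaugeCovariance (OrthFlow)
open Literature.MathematicalPhysics.QuantumFieldTheory.Balaban1983to89.B4Lower18 (fineDom mem_fineDom IsBlockUnion edistR)
open Literature.MathematicalPhysics.QuantumFieldTheory.Balaban1983to89.B4Lower18Regular (e1)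
open Literature.MathematicalPhysics.QuantumFieldTheory.Balaban1983to89.B4Lower18RegularRegion (rbaseEmb base_mem_fineDom)
open Literature.MathematicalPhysics.QuantumFieldTheory.Balaban1983to89.B4Reflection242 (blk blk_mul supNorm_le_of_forall)
open Literature.MathematicalPhysics.QuantumFieldTheory.Balaban1983to89.B4ContourShift (supNorm supNorm_nonneg
  abs_le_supNorm exists_supNorm_eq)
open Literature.MathematicalPhysics.QuantumFieldTheory.Balaban1983to89.B4TwoRegion120 (incl incl_val)
open Literature.MathematicalPhysics.QuantumFieldTheory.Balaban1983to89.B4Cor23ZeroDelta (setDist setDist_le outR mem_outR)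
open Literature.MathematicalPhysics.QuantumFieldTheory.Balaban1983to89.B4Cor23RegionEta (RegularPairInstance)
open Literature.MathematicalPhysics.QuantumFieldTheory.Balaban1983to89.B4Cor23RegularWindow (RegularPairInstanceW
  prop22Small_regularPairW)
open Literature.MathematicalPhysics.QuantumFieldTheory.Balaban1983to89.B1Prop22RegularField (regDict Sph)

noncomputable section

variable {d : ℕ} {ι : Type} [Fintype ι] [DecidableEq ι]

/-- `vδ_y`: the one-site configuration of `B1Prop22RegularFieldAlg` (alias, to keep `Matrix.single` out of the way).
[cite: Balaban1982Higgs1, (2.27) p.611] -/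
abbrev sgl {Y : Type} [DecidableEq Y] (y : Y) (v : ι → ℝ) : Y × ι → ℝ := B1Prop22RegularFieldAlg.single y v

/-! ## §1 Block operator norms dominate matrix elements

`|Δ^{(k)}(Ω,A;y,y′)|` in `B1Prop22RegularField` is the operator norm of the `N × N` block, typed as the supremum over
pairs of unit vectors; the printed `h_k(x,x′)` are matrix elements.  [cite: Balaban1982Higgs2, (2.109) p.580] -/

section Entry

variable {Y Y₀ : Type} [Fintype Y] [DecidableEq Y] [Fintype Y₀] [DecidableEq Y₀]

omit [DecidableEq ι] in
/-- a unit vector of `R^N` has coordinates of modulus `≤ 1`. [folklore] -/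
private theorem abs_sph_apply_le_one (v : Sph ι) (j : ι) : |v.1 j| ≤ 1 := by
  rw [← sq_le_one_iff_abs_le_one]
  have h : v.1 j * v.1 j ≤ ∑ i, v.1 i * v.1 i :=
    Finset.single_le_sum (f := fun i => v.1 i * v.1 i) (fun i _ => mul_self_nonneg _) (Finset.mem_univ j)
  have h1 : ∑ i, v.1 i * v.1 i = 1 := v.2
  rw [pow_two]
  linarith

omit [DecidableEq ι] [Fintype Y] in
/-- the one-site configuration of a unit vector has entries of modulus `≤ 1`. [folklore] -/
private theorem abs_sgl_le_one (y : Y) (v : Sph ι) (a : Y × ι) : |sgl y v.1 a| ≤ 1 := by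
  unfold sgl B1Prop22RegularFieldAlg.single
  split_ifs
  · exact abs_sph_apply_le_one v a.2
  · simp

/-- `|⟨u, Kw⟩| ≤ Σ|K_{ab}|` when all entries of `u, w` have modulus `≤ 1`. [folklore] -/
private theorem abs_dot_mulVec_le {J : Type} [Fintype J] (K : Matrix J J ℝ) {u w : J → ℝ} (hu : ∀ a, |u a| ≤ 1)
    (hw : ∀ a, |w a| ≤ 1) : |u ⬝ᵥ (K *ᵥ w)| ≤ ∑ a, ∑ b, |K a b| := by
  refine (Finset.abs_sum_le_sum_abs _ _).trans (Finset.sum_le_sum fun a _ => ?_)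
  rw [abs_mul]
  refine (mul_le_of_le_one_left (abs_nonneg _) (hu a)).trans ?_
  refine (Finset.abs_sum_le_sum_abs _ _).trans (Finset.sum_le_sum fun b _ => ?_)
  rw [abs_mul]
  exact mul_le_of_le_one_right (abs_nonneg _) (hw b)

omit [Fintype ι] [Fintype Y] in
/-- `vδ_y` with `v = e_j` is the basis vector `δ_{(y,j)}`. [folklore] -/
private theorem sgl_single (y : Y) (j : ι) : sgl y (Pi.single j (1 : ℝ)) = Pi.single (y, j) (1 : ℝ) := by
  funext a
  unfold sgl B1Prop22RegularFieldAlg.single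
  by_cases h1 : a.1 = y
  · by_cases h2 : a.2 = j
    · have : a = (y, j) := Prod.ext h1 h2
      rw [if_pos h1, h2, this]; simp
    · have : a ≠ (y, j) := fun h => h2 (by rw [h])
      rw [if_pos h1, Pi.single_eq_of_ne h2, Pi.single_eq_of_ne this]
  · have : a ≠ (y, j) := fun h => h1 (by rw [h])
    rw [if_neg h1, Pi.single_eq_of_ne this]

/-- a matrix element as a one-site pairing: `K((y,j),(y′,j′)) = ⟨e_jδ_y, K e_{j′}δ_{y′}⟩`. [folklore] -/
private theorem entry_eq_sgl_dot (K : Matrix (Y × ι) (Y × ι) ℝ) (y y' : Y) (j j' : ι) :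
    K (y, j) (y', j') = sgl y (Pi.single j (1 : ℝ)) ⬝ᵥ (K *ᵥ sgl y' (Pi.single j' (1 : ℝ))) := by
  rw [sgl_single, sgl_single, single_dotProduct, one_mul, Matrix.mulVec, dotProduct_single, mul_one]

/-- the pair `(e_j, e_{j′})` of unit vectors. [folklore] -/
def basisPair (j j' : ι) : Sph ι × Sph ι := (⟨Pi.single j 1, by simp⟩, ⟨Pi.single j' 1, by simp⟩)

/-- **a matrix element is dominated by the block operator norm** (`|Δ(y,j;y′,j′)| ≤ |Δ^{(k)}(Ω,A;y,y′)|` in the sense of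
`B1Prop22RegularField.regDict`). [cite: Balaban1982Higgs1, (2.27) p.611] -/
theorem abs_entry_le_iSup (K : Matrix (Y × ι) (Y × ι) ℝ) (y y' : Y) (j j' : ι) :
    |K (y, j) (y', j')| ≤ ⨆ p : Sph ι × Sph ι, |sgl y p.1.1 ⬝ᵥ (K *ᵥ sgl y' p.2.1)| := by
  have hb : BddAbove (Set.range fun p : Sph ι × Sph ι => |sgl y p.1.1 ⬝ᵥ (K *ᵥ sgl y' p.2.1)|) := by
    refine ⟨∑ a, ∑ b, |K a b|, ?_⟩
    rintro _ ⟨p, rfl⟩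
    exact abs_dot_mulVec_le K (abs_sgl_le_one y p.1) (abs_sgl_le_one y' p.2)
  rw [entry_eq_sgl_dot K y y' j j']
  exact le_ciSup hb (basisPair j j')

/-- **a matrix element of a difference of two regions' operators is dominated by the block operator norm of the
difference** (`|δΔ(y,j;y′,j′)| ≤ |δΔ^{(k)}(Ω,Ω₀,A;y,y′)|` in the sense of `regDict`). [cite: Balaban1982Higgs1, (2.29) p.611] -/
theorem abs_entry_sub_le_iSup (K : Matrix (Y × ι) (Y × ι) ℝ) (K₀ : Matrix (Y₀ × ι) (Y₀ × ι) ℝ) (f : Y → Y₀)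
    (y y' : Y) (j j' : ι) :
    |K (y, j) (y', j') - K₀ (f y, j) (f y', j')| ≤ ⨆ p : Sph ι × Sph ι,
      |sgl y p.1.1 ⬝ᵥ (K *ᵥ sgl y' p.2.1) - sgl (f y) p.1.1 ⬝ᵥ (K₀ *ᵥ sgl (f y') p.2.1)| := by
  have hb : BddAbove (Set.range fun p : Sph ι × Sph ι =>
      |sgl y p.1.1 ⬝ᵥ (K *ᵥ sgl y' p.2.1) - sgl (f y) p.1.1 ⬝ᵥ (K₀ *ᵥ sgl (f y') p.2.1)|) := by
    refine ⟨(∑ a, ∑ b, |K a b|) + ∑ a, ∑ b, |K₀ a b|, ?_⟩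
    rintro _ ⟨p, rfl⟩
    exact (abs_sub _ _).trans (add_le_add (abs_dot_mulVec_le K (abs_sgl_le_one y p.1) (abs_sgl_le_one y' p.2))
      (abs_dot_mulVec_le K₀ (abs_sgl_le_one (f y) p.1) (abs_sgl_le_one (f y') p.2)))
  rw [entry_eq_sgl_dot K, entry_eq_sgl_dot K₀]
  exact le_ciSup hb (basisPair j j')

end Entry

/-! ## §2 Geometry: unit-label separations bound the printed distances from below

`|y − y′|` of (2.27) is the sup-distance of the unit labels (`B1Prop22RegularField.Inst.udist_eq`); `dist(y, Ω^{(k)c})` of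
(2.29) is read (b04) as the η-distance from the base corner of `B(y)` to the fine points of `Ω₀ ∖ Ω`.  A separation
`|y − u| ≥ R` of `y` from every unit label `u` of `Ω₀ ∖ Ω` gives `dist(y, Ω^{(k)c}) ≥ R − 1`.
[cite: Balaban1982Higgs2, (2.8) p.558; Balaban1982Higgs1, (2.29) p.611] -/

section Geometry

/-- the sup norm is even. [folklore] -/
private theorem supNorm_neg (x : Fin (d + 1) → ℤ) : supNorm (-x) = supNorm x := by
  unfold B4ContourShift.supNorm
  congr 1
  funext i
  simp

/-- the sup distance is symmetric. [folklore] -/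
private theorem supNorm_sub_comm (x y : Fin (d + 1) → ℤ) : supNorm (x - y) = supNorm (y - x) := by
  rw [← supNorm_neg, neg_sub]

/-- **corner versus block**: for a fine point `z` of the block `B(u)`, `u = blk n z`, the η-distance from the base corner
`n·y` of `B(y)` to `z` is at least `|y − u| − 1`; in integers, `n·|y − u|_∞ − (n − 1) ≤ |n·y − z|_∞`. [folklore] -/
private theorem supNorm_corner_sub_ge {n : ℕ} (hn : 1 ≤ n) (y z : Fin (d + 1) → ℤ) :
    (n : ℝ) * supNorm (y - blk n z) - ((n : ℝ) - 1) ≤ supNorm ((fun i => (n : ℤ) * y i) - z) := by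
  obtain ⟨i, hi⟩ := exists_supNorm_eq (y - blk n z)
  rw [hi]
  refine le_trans ?_ (abs_le_supNorm ((fun i => (n : ℤ) * y i) - z) i)
  have hn0 : (0 : ℤ) < n := by exact_mod_cast hn
  have hq := Int.mul_ediv_add_emod (z i) (n : ℤ)
  have hr0 := Int.emod_nonneg (z i) hn0.ne'
  have hr1 := Int.emod_lt_of_pos (z i) hn0
  simp only [Pi.sub_apply, Int.cast_abs, Int.cast_sub, Int.cast_mul, Int.cast_natCast]
  have hblk : (blk n z i : ℝ) = ((z i / (n : ℤ) : ℤ) : ℝ) := rfl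
  rw [hblk]
  set q : ℤ := z i / (n : ℤ) with hqdef
  set rm : ℤ := z i % (n : ℤ) with hrm
  have hz : (z i : ℝ) = (n : ℝ) * (q : ℝ) + (rm : ℝ) := by
    have := congrArg (fun t : ℤ => (t : ℝ)) hq
    push_cast at this
    linarith
  have hrm0 : (0 : ℝ) ≤ rm := by exact_mod_cast hr0
  have hrm1 : (rm : ℝ) ≤ (n : ℝ) - 1 := by
    have : rm + 1 ≤ (n : ℤ) := hr1
    have := (Int.cast_le (R := ℝ)).2 this
    push_cast at this
    linarith
  have hnn : (0 : ℝ) ≤ n := Nat.cast_nonneg n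
  rw [hz, show (n : ℝ) * (y i : ℝ) - ((n : ℝ) * q + rm) = (n : ℝ) * ((y i : ℝ) - q) - rm by ring]
  have h1 : |(n : ℝ) * ((y i : ℝ) - q)| - |(rm : ℝ)| ≤ |(n : ℝ) * ((y i : ℝ) - q) - rm| := abs_sub_abs_le_abs_sub _ _
  rw [abs_mul, abs_of_nonneg hnn, abs_of_nonneg hrm0] at h1
  linarith

/-- a lower bound for `setDist`: if the pair set is nonempty and every pairwise distance is `≥ c`. [folklore] -/
private theorem le_setDist {α : Type*} (dR : α → α → ℝ) {A B : Finset α} (hne : (A ×ˢ B).Nonempty) {c : ℝ}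
    (h : ∀ a ∈ A, ∀ b ∈ B, c ≤ dR a b) : c ≤ setDist dR A B := by
  unfold B4Cor23ZeroDelta.setDist
  rw [dif_pos hne]
  exact Finset.le_inf' hne _ fun p hp => by
    obtain ⟨ha, hb⟩ := Finset.mem_product.1 hp
    exact h p.1 ha p.2 hb

/-- **`dist(y, Ω^{(k)c}) ≥ R − 1`** for b04's reading of the boundary distance (base corner of `B(y)` to the fine points of
`Ω₀ ∖ Ω`), whenever `Ω₀ ∖ Ω` has a unit label and every unit label `u` of `Ω₀ ∖ Ω` is at sup-distance `≥ R` from `y`.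
[cite: Balaban1982Higgs1, (2.29) p.611] -/
theorem le_distOc (i : RegularPairInstance d) (y : ↥i.Ωc) {R : ℝ} (hne : ∃ u ∈ i.Ω₀c, u ∉ i.Ωc)
    (hR : ∀ u ∈ i.Ω₀c, u ∉ i.Ωc → R ≤ supNorm (y.1 - u)) :
    R - 1 ≤ B1Prop22RegularField.Inst.distOc i y := by
  have hn0 : (0 : ℝ) < i.n := by have := i.hn; positivity
  obtain ⟨u, hu, hu'⟩ := hne
  have hcu : (fun j => (i.n : ℤ) * u j) ∈ fineDom i.n i.Ω₀c := by rw [mem_fineDom i.hn, blk_mul i.hn]; exact hu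
  have hcu' : (fun j => (i.n : ℤ) * u j) ∉ fineDom i.n i.Ωc := by rw [mem_fineDom i.hn, blk_mul i.hn]; exact hu'
  have hout : (⟨_, hcu⟩ : ↥(fineDom i.n i.Ω₀c)) ∈ outR (fineDom i.n i.Ωc) (fineDom i.n i.Ω₀c) := mem_outR.2 hcu'
  unfold B1Prop22RegularField.Inst.distOc
  refine le_setDist _ ⟨_, Finset.mk_mem_product (Finset.mem_singleton_self _) hout⟩ fun a ha z hz => ?_
  rw [Finset.mem_singleton] at ha
  subst ha
  have hz1 : z.1 ∈ fineDom i.n i.Ω₀c := z.2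
  have hz2 : z.1 ∉ fineDom i.n i.Ωc := mem_outR.1 hz
  rw [mem_fineDom i.hn] at hz1 hz2
  have hRu := hR (blk i.n z.1) hz1 hz2
  have hcorner := supNorm_corner_sub_ge i.hn y.1 z.1
  unfold B4Lower18.edistR
  simp only [incl_val]
  have hval : (rbaseEmb i.hn i.Ωc y).1 = fun j => (i.n : ℤ) * y.1 j := rfl
  rw [hval]
  set S : ℝ := supNorm (y.1 - blk i.n z.1) with hS
  have hstep : R - 1 ≤ (1 / (i.n : ℝ)) * ((i.n : ℝ) * S - ((i.n : ℝ) - 1)) := by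
    have hcalc : (1 / (i.n : ℝ)) * ((i.n : ℝ) * S - ((i.n : ℝ) - 1)) = S - 1 + 1 / (i.n : ℝ) := by
      field_simp
      ring
    rw [hcalc]
    have : (0 : ℝ) ≤ 1 / (i.n : ℝ) := by positivity
    linarith
  exact hstep.trans (mul_le_mul_of_nonneg_left hcorner (by positivity))

/-- **(2.27) for matrix elements**: on a region pair of b04's family satisfying (2.27)/(2.29) with constants `(δ₀, c₀)`,
`|Δ^{(k)}(Ω,A)((y,j),(y′,j′))| ≤ c₀e^{−δ₀|y−y′|}`. [cite: Balaban1982Higgs1, (2.27) p.611] -/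
theorem abs_deltaK_entry_le [Nonempty ι] (F : OrthFlow ι) {a : ℝ} (ha : 0 < a) (c β : ℝ) (M : ℕ)
    (j : RegularPairInstance d) {δ₀ c₀ : ℝ} (hI : B1.Ineq227_229 (regDict F ha c β M j).toDelta δ₀ c₀)
    (y y' : ↥j.Ωc) (l l' : ι) :
    |B1Prop22RegularFieldAlg.deltaK F j.e j.hn a j.m2 j.Ωc j.Ac (y, l) (y', l')|
      ≤ c₀ * Real.exp (-(δ₀ * supNorm (y.1 - y'.1))) := by
  have h := hI.1 y y'
  have hu : (regDict F ha c β M j).toDelta.udist y y' = supNorm (y.1 - y'.1) :=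
    B1Prop22RegularField.Inst.udist_eq j y y'
  rw [hu] at h
  exact (abs_entry_le_iSup _ y y' l l').trans h

/-- **(2.29) for matrix elements**: on a region pair `Ω ⊆ Ω₀` of b04's family satisfying (2.27)/(2.29) with `(δ₀, c₀)`,
`|Δ^{(k)}(Ω,A)((y,j),(y′,j′)) − Δ^{(k)}(Ω₀,A)((y,j),(y′,j′))| ≤ c₀e^{−δ₀(|y−y′| + dist(y,Ω^{(k)c}) + dist(y′,Ω^{(k)c}))}`.
[cite: Balaban1982Higgs1, (2.29) p.611] -/
theorem abs_deltaK_entry_sub_le [Nonempty ι] (F : OrthFlow ι) {a : ℝ} (ha : 0 < a) (c β : ℝ) (M : ℕ)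
    (j : RegularPairInstance d) {δ₀ c₀ : ℝ} (hI : B1.Ineq227_229 (regDict F ha c β M j).toDelta δ₀ c₀)
    (y y' : ↥j.Ωc) (l l' : ι) :
    |B1Prop22RegularFieldAlg.deltaK F j.e j.hn a j.m2 j.Ωc j.Ac (y, l) (y', l')
        - B1Prop22RegularFieldAlg.deltaK F j.e j.hn a j.m2 j.Ω₀c j.Ac (incl j.hsub y, l) (incl j.hsub y', l')|
      ≤ c₀ * Real.exp (-(δ₀ * (supNorm (y.1 - y'.1) + B1Prop22RegularField.Inst.distOc j y
          + B1Prop22RegularField.Inst.distOc j y'))) := by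
  have h := hI.2 y y'
  have hu : (regDict F ha c β M j).toDelta.udist y y' = supNorm (y.1 - y'.1) :=
    B1Prop22RegularField.Inst.udist_eq j y y'
  rw [hu] at h
  exact (abs_entry_sub_le_iSup _ _ (incl j.hsub) y y' l l').trans h

/-- two regions with the same unit labels carry the same operator: `Δ^{(k)}(Ω,A)` at `(y, y′)` equals `Δ^{(k)}(Ω₀,A)` at the
included sites when `Ω = Ω₀` (used when a localization is void: `Λ₅^{(k)} = ∅` or `Λ₂^{(k)} = Λ₂^{(k−1)′}`). [folklore] -/
private theorem deltaK_entry_of_eq (F : OrthFlow ι) (e : ℝ) {n : ℕ} (hn : 1 ≤ n) (a m2 : ℝ)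
    (Ac : (Fin (d + 1) → ℤ) → Fin (d + 1) → ℝ) (S T : Finset (Fin (d + 1) → ℤ)) (hST : S = T) (h : S ⊆ T)
    (y y' : ↥S) (l l' : ι) :
    B1Prop22RegularFieldAlg.deltaK F e hn a m2 S Ac (y, l) (y', l') = B1Prop22RegularFieldAlg.deltaK F e hn a m2 T Ac (incl h y, l) (incl h y', l') := by
  subst hST
  have h1 : incl h y = y := Subtype.ext rfl
  have h2 : incl h y' = y' := Subtype.ext rfl
  rw [h1, h2]

end Geometry

/-! ## §3 One step of Sect. 2.C: the data of (2.108), the three regions, the operator `H_k`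

ONE INSTANCE = one step `k` of the procedure at a fixed admissible sequence and fixed fields: the mesh `η = L^{−k} = 1/n`,
the unit labels `Ωc = Λ₂^{(k−1)′}` of `Ω = B^k(Λ₂^{(k−1)′})`, the regular vector field `B̃` on `Ω` (the «large» part of
(2.93), p. 576), the mass `m²` and `a_k ∈ [a₋, a₊]` of `Δ^{(k)}`, and the sets of (2.108): `Λ₆^{(k−1)′} ⊇ Λ₃^{(k)} ⊇ Λ₄^{(k)} ⊇
Λ₅^{(k)}`, `Λ₂^{(k)} ⊇ Λ₃^{(k)}` (all unions of blocks of the unit lattice `T₁^{(k)}`, here: finite sets of unit labels in `ℤ^{d+1}`),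
with `r` = `r(Lᵏε)`.  [cite: Balaban1982Higgs2, (2.108) p.580, (2.7)–(2.8) p.558, p.566] -/

/-- The data of one step (see the section docstring; `Ωc` ↤ `Λ₂^{(k−1)′}`, `L6` ↤ `Λ₆^{(k−1)′}`, `L3 ⊇ L4 ⊇ L5` ↤
`Λ₃^{(k)} ⊇ Λ₄^{(k)} ⊇ Λ₅^{(k)}`, `L2k` ↤ `Λ₂^{(k)}`, `r` ↤ `r(Lᵏε)`, `Ac` ↤ `B̃`, `ak` ↤ `a_k`, `n` ↤ `Lᵏ`).
[cite: Balaban1982Higgs2, (2.108) p.580] -/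
structure Inst (d : ℕ) (aminus aplus : ℝ) where
  n : ℕ
  hn : 1 ≤ n
  e : ℝ
  Ac : (Fin (d + 1) → ℤ) → Fin (d + 1) → ℝ
  m2 : ℝ
  hm : 0 ≤ m2
  ak : ℝ
  hak : aminus ≤ ak
  hak' : ak ≤ aplus
  Ωc : Finset (Fin (d + 1) → ℤ)
  L6 : Finset (Fin (d + 1) → ℤ)
  L3 : Finset (Fin (d + 1) → ℤ)
  L4 : Finset (Fin (d + 1) → ℤ)
  L5 : Finset (Fin (d + 1) → ℤ)
  L2k : Finset (Fin (d + 1) → ℤ)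
  h6 : L6 ⊆ Ωc
  h36 : L3 ⊆ L6
  h43 : L4 ⊆ L3
  h54 : L5 ⊆ L4
  h32 : L3 ⊆ L2k
  h2k : L2k ⊆ Ωc
  r : ℝ

namespace Inst

variable {aminus aplus : ℝ} (i : Inst d aminus aplus) (F : OrthFlow ι)

/-- the region pair `(B^k(Ωs) ⊆ Ω = B^k(Λ₂^{(k−1)′}), B̃)` of b04's window family built on the instance's mesh, field,
mass and `a_k`. [cite: Balaban1982Higgs1, Prop. 2.2 p.611] -/
def pairW (Ωs : Finset (Fin (d + 1) → ℤ)) (h : Ωs ⊆ i.Ωc) : RegularPairInstanceW d aminus aplus where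
  n := i.n
  hn := i.hn
  Ωc := Ωs
  e := i.e
  Ac := i.Ac
  m2 := i.m2
  hm := i.hm
  Ω₀c := i.Ωc
  hsub := h
  ak := i.ak
  hak := i.hak
  hak' := i.hak'

/-- `Ω` against itself (for (I.2.27) on `Ω`). [cite: Balaban1982Higgs2, (2.108) p.580] -/
abbrev pair0 : RegularPairInstanceW d aminus aplus := i.pairW i.Ωc (Finset.Subset.refl _)

/-- `Ω₁ = B^k(Λ₂^{(k−1)′} ∩ Λ₅^{(k)c}) ⊆ Ω`. [cite: Balaban1982Higgs2, (2.108) p.580] -/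
abbrev pair1 : RegularPairInstanceW d aminus aplus := i.pairW (i.Ωc \ i.L5) Finset.sdiff_subset

/-- `Ω₂ = B^k(Λ₂^{(k)}) ⊆ Ω`. [cite: Balaban1982Higgs2, (2.108) p.580] -/
abbrev pair2 : RegularPairInstanceW d aminus aplus := i.pairW i.L2k i.h2k

/-- `Δ^{(k)}(Ω, B̃)`, `Ω = B^k(Λ₂^{(k−1)′})` (I (2.21) / B4 (1.14) on the unit sites `Ωc × {1,…,N}`).
[cite: Balaban1982Higgs2, (2.108) p.580; Balaban1982Higgs1, (2.21) p.610] -/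
def opΩ : Matrix (↥i.Ωc × ι) (↥i.Ωc × ι) ℝ := B1Prop22RegularFieldAlg.deltaK F i.e i.hn i.ak i.m2 i.Ωc i.Ac

/-- `Δ^{(k)}(Ω₁, B̃)`, `Ω₁ = B^k(Λ₂^{(k−1)′} ∩ Λ₅^{(k)c})`. [cite: Balaban1982Higgs2, (2.108) p.580] -/
def op1 : Matrix (↥(i.Ωc \ i.L5) × ι) (↥(i.Ωc \ i.L5) × ι) ℝ := B1Prop22RegularFieldAlg.deltaK F i.e i.hn i.ak i.m2 (i.Ωc \ i.L5) i.Ac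

/-- `Δ^{(k)}(Ω₂, B^{(k+1),η})`, `Ω₂ = B^k(Λ₂^{(k)})` — on `Ω₂` the field `B̃` of (2.93) IS `B^{(k+1),η}` (`θ_{k+1} ≡ 1` there,
p. 576), so this is the instance's field again. [cite: Balaban1982Higgs2, (2.108) p.580, (2.93) p.576] -/
def op2 : Matrix (↥i.L2k × ι) (↥i.L2k × ι) ℝ := B1Prop22RegularFieldAlg.deltaK F i.e i.hn i.ak i.m2 i.L2k i.Ac

/-- a point of `Λ₆^{(k−1)′}` outside `Λ₅^{(k)}` is a unit label of `Ω₁`. [cite: Balaban1982Higgs2, (2.108) p.580] -/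
theorem mem_sdiff_of (x : ↥i.L6) (hx : x.1 ∉ i.L5) : x.1 ∈ i.Ωc \ i.L5 := Finset.mem_sdiff.2 ⟨i.h6 x.2, hx⟩

/-- the kernel of `Λ₆′Δ^{(k)}(Ω,B̃)Λ₆′` on `X = Λ₆^{(k−1)′} × {1,…,N}`. [cite: Balaban1982Higgs2, (2.108) p.580] -/
def DΩ (p q : ↥i.L6 × ι) : ℝ := i.opΩ F (incl i.h6 p.1, p.2) (incl i.h6 q.1, q.2)

/-- the kernel of `Δ^{(k)}(Ω₁,B̃)` read on `X` (zero where undefined, i.e. on `Λ₅^{(k)}`). [cite: Balaban1982Higgs2, (2.108) p.580] -/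
def D1 (p q : ↥i.L6 × ι) : ℝ :=
  if h : p.1.1 ∉ i.L5 ∧ q.1.1 ∉ i.L5 then
    i.op1 F (⟨p.1.1, i.mem_sdiff_of p.1 h.1⟩, p.2) (⟨q.1.1, i.mem_sdiff_of q.1 h.2⟩, q.2) else 0

/-- the kernel of `Δ^{(k)}(Ω₂,B^{(k+1),η})` read on `X` (zero outside `Λ₃^{(k)}`, where it is not used).
[cite: Balaban1982Higgs2, (2.108) p.580] -/
def D2 (p q : ↥i.L6 × ι) : ℝ :=
  if h : p.1.1 ∈ i.L3 ∧ q.1.1 ∈ i.L3 then i.op2 F (⟨p.1.1, i.h32 h.1⟩, p.2) (⟨q.1.1, i.h32 h.2⟩, q.2) else 0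

/-- the full form's matrix `Λ₆′Δ^{(k)}(B^k(Λ₂^{(k−1)′}),B̃)Λ₆′` on `X`. [cite: Balaban1982Higgs2, (2.108) p.580] -/
def MΩ : Matrix (↥i.L6 × ι) (↥i.L6 × ι) ℝ := Matrix.of (i.DΩ F)

/-- second term of (2.108): `(Λ₆′∩Λ₃ᶜ)Δ^{(k)}(Ω₁,B̃)(Λ₆′∩Λ₃ᶜ)`. [cite: Balaban1982Higgs2, (2.108) p.580] -/
def MPP : Matrix (↥i.L6 × ι) (↥i.L6 × ι) ℝ :=
  Matrix.of fun p q => if p.1.1 ∉ i.L3 ∧ q.1.1 ∉ i.L3 then i.D1 F p q else 0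

/-- third term of (2.108), right half: `(Λ₆′∩Λ₃ᶜ)Δ^{(k)}(Ω₁,B̃)(Λ₃∩Λ₄ᶜ)`. [cite: Balaban1982Higgs2, (2.108) p.580] -/
def MP34 : Matrix (↥i.L6 × ι) (↥i.L6 × ι) ℝ :=
  Matrix.of fun p q => if p.1.1 ∉ i.L3 ∧ (q.1.1 ∈ i.L3 ∧ q.1.1 ∉ i.L4) then i.D1 F p q else 0

/-- third term of (2.108), left half (the form is symmetric; the print writes the cross term once, without `½`):
`(Λ₃∩Λ₄ᶜ)Δ^{(k)}(Ω₁,B̃)(Λ₆′∩Λ₃ᶜ)`. [cite: Balaban1982Higgs2, (2.108) p.580] -/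
def M34P : Matrix (↥i.L6 × ι) (↥i.L6 × ι) ℝ :=
  Matrix.of fun p q => if (p.1.1 ∈ i.L3 ∧ p.1.1 ∉ i.L4) ∧ q.1.1 ∉ i.L3 then i.D1 F p q else 0

/-- fourth term of (2.108): `Λ₃Δ^{(k)}(B^k(Λ₂^{(k)}),B^{(k+1),η})Λ₃`. [cite: Balaban1982Higgs2, (2.108) p.580] -/
def M33 : Matrix (↥i.L6 × ι) (↥i.L6 × ι) ℝ :=
  Matrix.of fun p q => if p.1.1 ∈ i.L3 ∧ q.1.1 ∈ i.L3 then i.D2 F p q else 0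

/-- **`H_k`** p. 580: *"More exactly the difference between the quadratic forms is a quadratic form ½⟨Λ₆^{(k−1)′}φ,
H_kΛ₆^{(k−1)′}φ⟩"* — the matrix of `Λ₆′Δ^{(k)}(B^k(Λ₂^{(k−1)′}),B̃)Λ₆′` MINUS the matrices of the three localized forms of
(2.108). [cite: Balaban1982Higgs2, (2.108)–(2.109) p.580] -/
def Hk : Matrix (↥i.L6 × ι) (↥i.L6 × ι) ℝ := i.MΩ F - i.MPP F - i.MP34 F - i.M34P F - i.M33 F

/-- `h_k(x,x′)`: the matrix elements of `H_k`. [cite: Balaban1982Higgs2, (2.109) p.580] -/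
abbrev hk (p q : ↥i.L6 × ι) : ℝ := i.Hk F p q

/-- **(2.108), the splitting, EXACTLY**: `⟨Λ₆′φ, Δ^{(k)}(Ω,B̃)Λ₆′φ⟩ = ⟨Pφ, Δ^{(k)}(Ω₁,B̃)Pφ⟩ + (⟨Pφ, Δ^{(k)}(Ω₁,B̃)(Λ₃∩Λ₄ᶜ)φ⟩ +
⟨(Λ₃∩Λ₄ᶜ)φ, Δ^{(k)}(Ω₁,B̃)Pφ⟩) + ⟨Λ₃φ, Δ^{(k)}(Ω₂,B^{(k+1),η})Λ₃φ⟩ + ⟨Λ₆′φ, H_kΛ₆′φ⟩`, `P = Λ₆^{(k−1)′} ∩ Λ₃^{(k)c}` (halve it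
for the printed `½`'s; the two cross halves are equal, `form_M34P_eq`). [cite: Balaban1982Higgs2, (2.108) p.580] -/
theorem eq2108_split (φ : ↥i.L6 × ι → ℝ) :
    φ ⬝ᵥ (i.MΩ F *ᵥ φ) = φ ⬝ᵥ (i.MPP F *ᵥ φ) + (φ ⬝ᵥ (i.MP34 F *ᵥ φ) + φ ⬝ᵥ (i.M34P F *ᵥ φ))
      + φ ⬝ᵥ (i.M33 F *ᵥ φ) + φ ⬝ᵥ (i.Hk F *ᵥ φ) := by
  simp only [Hk, Matrix.sub_mulVec, dotProduct_sub]
  ring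


/-! ### symmetry: the two halves of the cross term of (2.108) agree -/

/-- `Δ^{(k)}(Ω,A)` is symmetric (`G_k(Ω,A)` is: b04's `green_transpose`). [cite: Balaban1982Higgs1, (2.21) p.610] -/
private theorem deltaK_transpose (e : ℝ) {n : ℕ} (hn : 1 ≤ n) (a m2 : ℝ) (Ωc : Finset (Fin (d + 1) → ℤ))
    (Ac : (Fin (d + 1) → ℤ) → Fin (d + 1) → ℝ) :
    (B1Prop22RegularFieldAlg.deltaK F e hn a m2 Ωc Ac)ᵀ = B1Prop22RegularFieldAlg.deltaK F e hn a m2 Ωc Ac := by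
  rw [B1Prop22RegularFieldAlg.deltaK_eq, Matrix.transpose_sub, Matrix.transpose_smul, Matrix.transpose_one,
    Matrix.transpose_smul, Matrix.transpose_mul, Matrix.transpose_mul, Matrix.transpose_transpose,
    B4Cor23RegionDeltaAlg.green_transpose, Matrix.mul_assoc]

/-- the `Ω₁`-kernel read on `X` is symmetric. [cite: Balaban1982Higgs2, (2.108) p.580] -/
theorem D1_comm (p q : ↥i.L6 × ι) : i.D1 F p q = i.D1 F q p := by
  unfold D1
  by_cases h : p.1.1 ∉ i.L5 ∧ q.1.1 ∉ i.L5
  · rw [dif_pos h, dif_pos ⟨h.2, h.1⟩]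
    have ht := deltaK_transpose F i.e i.hn i.ak i.m2 (i.Ωc \ i.L5) i.Ac
    unfold op1
    exact (congrFun (congrFun ht _) _).symm.trans (Matrix.transpose_apply _ _ _)
  · have h' : ¬(q.1.1 ∉ i.L5 ∧ p.1.1 ∉ i.L5) := fun h2 => h ⟨h2.2, h2.1⟩
    rw [dif_neg h, dif_neg h']

/-- the left half of the cross term is the transpose of the right half. [cite: Balaban1982Higgs2, (2.108) p.580] -/
theorem M34P_eq_transpose : i.M34P F = (i.MP34 F)ᵀ := by
  ext p q
  simp only [M34P, MP34, Matrix.transpose_apply, Matrix.of_apply]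
  by_cases h : (p.1.1 ∈ i.L3 ∧ p.1.1 ∉ i.L4) ∧ q.1.1 ∉ i.L3
  · rw [if_pos h, if_pos ⟨h.2, h.1⟩, D1_comm]
  · have h' : ¬(q.1.1 ∉ i.L3 ∧ (p.1.1 ∈ i.L3 ∧ p.1.1 ∉ i.L4)) := fun h2 => h ⟨h2.2, h2.1⟩
    rw [if_neg h, if_neg h']

/-- **the two cross halves of (2.108) are EQUAL** (so their sum is the printed `⟨(Λ₆′∩Λ₃ᶜ)φ, Δ^{(k)}(Ω₁,B̃)(Λ₃∩Λ₄ᶜ)φ⟩`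
written once without `½`). [cite: Balaban1982Higgs2, (2.108) p.580] -/
theorem form_M34P_eq (φ : ↥i.L6 × ι → ℝ) : φ ⬝ᵥ (i.M34P F *ᵥ φ) = φ ⬝ᵥ (i.MP34 F *ᵥ φ) := by
  rw [M34P_eq_transpose, Matrix.mulVec_transpose, dotProduct_comm, ← Matrix.dotProduct_mulVec]

/-- (2.108) with the cross term written once, as printed: `⟨Λ₆′φ,Δ(Ω)Λ₆′φ⟩ = ⟨Pφ,Δ(Ω₁)Pφ⟩ + 2⟨Pφ,Δ(Ω₁)(Λ₃∖Λ₄)φ⟩ +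
⟨Λ₃φ,Δ(Ω₂)Λ₃φ⟩ + ⟨Λ₆′φ,H_kΛ₆′φ⟩` (halve for the printed `½`'s). [cite: Balaban1982Higgs2, (2.108) p.580] -/
theorem eq2108_split_printed (φ : ↥i.L6 × ι → ℝ) :
    φ ⬝ᵥ (i.MΩ F *ᵥ φ) = φ ⬝ᵥ (i.MPP F *ᵥ φ) + 2 * (φ ⬝ᵥ (i.MP34 F *ᵥ φ))
      + φ ⬝ᵥ (i.M33 F *ᵥ φ) + φ ⬝ᵥ (i.Hk F *ᵥ φ) := by
  rw [eq2108_split, form_M34P_eq]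
  ring

/-! ### the matrix elements of `H_k` block by block -/

section Blocks

variable {i F}

/-- block `P × P`: `h_k = Δ(Ω) − Δ(Ω₁) = −δΔ^{(k)}(Ω₁,Ω,B̃)`. [cite: Balaban1982Higgs2, (2.108) p.580] -/
theorem hk_PP {p q : ↥i.L6 × ι} (hp : p.1.1 ∉ i.L3) (hq : q.1.1 ∉ i.L3) :
    i.hk F p q = i.DΩ F p q - i.D1 F p q := by
  have hq4 : q.1.1 ∉ i.L4 := fun h => hq (i.h43 h)
  simp [hk, Hk, MΩ, MPP, MP34, M34P, M33, hp, hq]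

/-- block `P × (Λ₃∩Λ₄ᶜ)`: `h_k = Δ(Ω) − Δ(Ω₁)`. [cite: Balaban1982Higgs2, (2.108) p.580] -/
theorem hk_P34 {p q : ↥i.L6 × ι} (hp : p.1.1 ∉ i.L3) (hq3 : q.1.1 ∈ i.L3) (hq4 : q.1.1 ∉ i.L4) :
    i.hk F p q = i.DΩ F p q - i.D1 F p q := by
  simp [hk, Hk, MΩ, MPP, MP34, M34P, M33, hp, hq3, hq4]

/-- block `P × Λ₄`: nothing is subtracted, `h_k = Δ^{(k)}(Ω,B̃)(x,x′)` at `|x − x′| > r`. [cite: Balaban1982Higgs2, (2.108) p.580] -/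
theorem hk_P4 {p q : ↥i.L6 × ι} (hp : p.1.1 ∉ i.L3) (hq4 : q.1.1 ∈ i.L4) :
    i.hk F p q = i.DΩ F p q := by
  have hq3 : q.1.1 ∈ i.L3 := i.h43 hq4
  simp [hk, Hk, MΩ, MPP, MP34, M34P, M33, hp, hq3, hq4]

/-- block `(Λ₃∩Λ₄ᶜ) × P`: `h_k = Δ(Ω) − Δ(Ω₁)`. [cite: Balaban1982Higgs2, (2.108) p.580] -/
theorem hk_34P {p q : ↥i.L6 × ι} (hp3 : p.1.1 ∈ i.L3) (hp4 : p.1.1 ∉ i.L4) (hq : q.1.1 ∉ i.L3) :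
    i.hk F p q = i.DΩ F p q - i.D1 F p q := by
  simp [hk, Hk, MΩ, MPP, MP34, M34P, M33, hp3, hp4, hq]

/-- block `Λ₄ × P`: `h_k = Δ^{(k)}(Ω,B̃)(x,x′)`. [cite: Balaban1982Higgs2, (2.108) p.580] -/
theorem hk_4P {p q : ↥i.L6 × ι} (hp4 : p.1.1 ∈ i.L4) (hq : q.1.1 ∉ i.L3) :
    i.hk F p q = i.DΩ F p q := by
  have hp3 : p.1.1 ∈ i.L3 := i.h43 hp4
  simp [hk, Hk, MΩ, MPP, MP34, M34P, M33, hp3, hp4, hq]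

/-- block `Λ₃ × Λ₃`: `h_k = Δ(Ω,B̃) − Δ(Ω₂,B^{(k+1),η}) = −δΔ^{(k)}(Ω₂,Ω,B̃)`. [cite: Balaban1982Higgs2, (2.108) p.580] -/
theorem hk_33 {p q : ↥i.L6 × ι} (hp3 : p.1.1 ∈ i.L3) (hq3 : q.1.1 ∈ i.L3) :
    i.hk F p q = i.DΩ F p q - i.D2 F p q := by
  simp [hk, Hk, MΩ, MPP, MP34, M34P, M33, hp3, hq3]

/-- off `Λ₅^{(k)}`, `Δ(Ω)(x,x′) − Δ(Ω₁)(x,x′)` IS the matrix element of `−δΔ^{(k)}(Ω₁,Ω,B̃)` of b04's pair `Ω₁ ⊆ Ω`.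
[cite: Balaban1982Higgs1, (2.28) p.611] -/
theorem DΩ_sub_D1 {p q : ↥i.L6 × ι} (hp : p.1.1 ∉ i.L5) (hq : q.1.1 ∉ i.L5) :
    i.DΩ F p q - i.D1 F p q
      = -(B1Prop22RegularFieldAlg.deltaK F i.e i.hn i.ak i.m2 (i.Ωc \ i.L5) i.Ac
            ((⟨p.1.1, i.mem_sdiff_of p.1 hp⟩ : ↥(i.Ωc \ i.L5)), p.2) (⟨q.1.1, i.mem_sdiff_of q.1 hq⟩, q.2)
          - B1Prop22RegularFieldAlg.deltaK F i.e i.hn i.ak i.m2 i.Ωc i.Ac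
            (incl Finset.sdiff_subset (⟨p.1.1, i.mem_sdiff_of p.1 hp⟩ : ↥(i.Ωc \ i.L5)), p.2)
            (incl Finset.sdiff_subset (⟨q.1.1, i.mem_sdiff_of q.1 hq⟩ : ↥(i.Ωc \ i.L5)), q.2)) := by
  rw [D1, dif_pos ⟨hp, hq⟩]
  simp only [DΩ, opΩ, op1, neg_sub]
  rfl

/-- on `Λ₃^{(k)}`, `Δ(Ω)(x,x′) − Δ(Ω₂)(x,x′)` IS the matrix element of `−δΔ^{(k)}(Ω₂,Ω,B̃)` of b04's pair `Ω₂ ⊆ Ω`.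
[cite: Balaban1982Higgs1, (2.28) p.611] -/
theorem DΩ_sub_D2 {p q : ↥i.L6 × ι} (hp : p.1.1 ∈ i.L3) (hq : q.1.1 ∈ i.L3) :
    i.DΩ F p q - i.D2 F p q
      = -(B1Prop22RegularFieldAlg.deltaK F i.e i.hn i.ak i.m2 i.L2k i.Ac
            ((⟨p.1.1, i.h32 hp⟩ : ↥i.L2k), p.2) (⟨q.1.1, i.h32 hq⟩, q.2)
          - B1Prop22RegularFieldAlg.deltaK F i.e i.hn i.ak i.m2 i.Ωc i.Ac
            (incl i.h2k (⟨p.1.1, i.h32 hp⟩ : ↥i.L2k), p.2) (incl i.h2k (⟨q.1.1, i.h32 hq⟩ : ↥i.L2k), q.2)) := by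
  rw [D2, dif_pos ⟨hp, hq⟩]
  simp only [DΩ, opΩ, op2, neg_sub]
  rfl

/-- `Δ(Ω)(x,x′)` IS the matrix element of b04's pair `Ω ⊆ Ω` at the included sites. [cite: Balaban1982Higgs1, (2.27) p.611] -/
theorem DΩ_eq (p q : ↥i.L6 × ι) :
    i.DΩ F p q = B1Prop22RegularFieldAlg.deltaK F i.e i.hn i.ak i.m2 i.Ωc i.Ac
      ((incl i.h6 p.1 : ↥i.Ωc), p.2) (incl i.h6 q.1, q.2) := rfl

end Blocks

end Inst

/-! ## §4 (2.109), the FIRST inequality, by the printed route «using Proposition I.2.2»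

The standing context of the step (the hypotheses of Prop. I.2.2 for `(Ω, B̃)`: regularity (I.2.23) = b04's (1.7) on `Ω`,
«e(Lᵏε) sufficiently small», the regions unions of big blocks) and the separations of the sets (2.8) are collected in
`Adm`.  [cite: Balaban1982Higgs2, (2.108)–(2.109) p.580, (2.93)–(2.98) pp.576–577, (2.8) p.558] -/

/-- The standing context of the step `k` for the instance `i` (family parameters `c, β` of (I.2.23)/(1.7), big-block size
`M`, charge threshold `e₁`): `reg` ↤ *"this configuration satisfies the regularity assumption of Proposition I.2.1"*
(p. 579; (2.94)–(2.98)), in b04's lattice form on `Ω`; `blkΩ/blk1/blk2` ↤ the regions `Ω, Ω₁, Ω₂` are unions of big blocks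
(hypothesis of Prop. I.2.1); `he/he1` ↤ *"for e(Lᵏε) sufficiently small"*; `hr` ↤ `r(Lᵏε) ≥ 0`; `sep45/sep34/sep2k` ↤ the
construction (2.8) p. 558 (*"Λ_{i+1}^c is the sum of all large blocks of T₁ with distances from the set Λ_i^c less or equal
r(ε)"*, at scale `Lᵏε`): points of `Λ₅^{(k)}` are `≥ r` away from `Λ₄^{(k)c}`, points of `Λ₄^{(k)}` from `Λ₃^{(k)c}`, points of
`Λ₃^{(k)}` from `Λ₂^{(k)c}` (sup-distance of unit labels). [cite: Balaban1982Higgs2, (2.108)–(2.109) p.580, (2.8) p.558] -/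
structure Adm {aminus aplus : ℝ} (c β : ℝ) (M : ℕ) (e₁ : ℝ) (i : Inst d aminus aplus) : Prop where
  reg : ∀ x ∈ fineDom i.n i.Ωc, ∀ μ ν : Fin (d + 1), |i.Ac (x + e1 μ) ν - i.Ac x ν| ≤ c * i.e ^ (β - 1) / i.n
  blkΩ : IsBlockUnion (M * i.n) (fineDom i.n i.Ωc)
  blk1 : IsBlockUnion (M * i.n) (fineDom i.n (i.Ωc \ i.L5))
  blk2 : IsBlockUnion (M * i.n) (fineDom i.n i.L2k)
  he : 0 < i.e
  he1 : i.e ≤ e₁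
  hr : 0 ≤ i.r
  sep45 : ∀ x ∈ i.L6, x ∉ i.L4 → ∀ u ∈ i.L5, i.r ≤ supNorm (x - u)
  sep34 : ∀ x ∈ i.L6, x ∉ i.L3 → ∀ u ∈ i.L4, i.r ≤ supNorm (x - u)
  sep2k : ∀ x ∈ i.L3, ∀ u ∈ i.Ωc, u ∉ i.L2k → i.r ≤ supNorm (x - u)

section Arith

/-- the doubly-damped bound: `c₀e^{−δ₀(D + d₁ + d₂)} ≤ c₀e^{2δ₀}·e^{−(δ₀/2)r}·e^{−(δ₀/2)D}` for `D, r ≥ 0`, `d₁, d₂ ≥ r − 1`.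
[folklore] -/
private theorem damped_le {c₀ δ₀ D d₁ d₂ r : ℝ} (hc : 0 ≤ c₀) (hδ : 0 ≤ δ₀) (hD : 0 ≤ D) (hr : 0 ≤ r) (h1 : r - 1 ≤ d₁)
    (h2 : r - 1 ≤ d₂) :
    c₀ * Real.exp (-(δ₀ * (D + d₁ + d₂)))
      ≤ c₀ * Real.exp (2 * δ₀) * Real.exp (-(δ₀ / 2 * r)) * Real.exp (-(δ₀ / 2 * D)) := by
  rw [mul_assoc, mul_assoc, ← Real.exp_add, ← Real.exp_add]
  refine mul_le_mul_of_nonneg_left (Real.exp_le_exp.2 ?_) hc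
  nlinarith [mul_nonneg hδ hD, mul_nonneg hδ hr, mul_le_mul_of_nonneg_left h1 hδ, mul_le_mul_of_nonneg_left h2 hδ]

/-- the far bound: `c₀e^{−δ₀D} ≤ c₀e^{2δ₀}·e^{−(δ₀/2)r}·e^{−(δ₀/2)D}` for `D ≥ r ≥ 0`. [folklore] -/
private theorem far_le {c₀ δ₀ D r : ℝ} (hc : 0 ≤ c₀) (hδ : 0 ≤ δ₀) (hD : r ≤ D) :
    c₀ * Real.exp (-(δ₀ * D))
      ≤ c₀ * Real.exp (2 * δ₀) * Real.exp (-(δ₀ / 2 * r)) * Real.exp (-(δ₀ / 2 * D)) := by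
  rw [mul_assoc, mul_assoc, ← Real.exp_add, ← Real.exp_add]
  refine mul_le_mul_of_nonneg_left (Real.exp_le_exp.2 ?_) hc
  nlinarith [mul_le_mul_of_nonneg_left hD hδ]

/-- the bound is non-negative. [folklore] -/
private theorem rhs_nonneg {c₀ δ₀ D r : ℝ} (hc : 0 ≤ c₀) :
    0 ≤ c₀ * Real.exp (2 * δ₀) * Real.exp (-(δ₀ / 2 * r)) * Real.exp (-(δ₀ / 2 * D)) := by positivity

end Arith

namespace Inst

variable {aminus aplus : ℝ}

/-- **(2.109), FIRST INEQUALITY — POINTWISE, for the concrete `Δ^{(k)}(Ω,B̃)` at a regular field.**  For `N ≥ 1`, every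
orthogonal flow `U` with `‖(U(t)−1)v‖ ≤ ℓt‖v‖`, every window `0 < a₋ ≤ a₊` for `a_k`, regularity constants `c ≥ 0, β > 0` and
big-block size `M`, there are `e₁ > 0` and `C ≥ 0, δ₀ > 0, δ₁ > 0` such that for EVERY admissible step (`Adm`: mesh, regions,
regular field `B̃` on `Ω = B^k(Λ₂^{(k−1)′})`, charge `e ≤ e₁`, the sets of (2.108) with their (2.8)-separations `≥ r`):
`|h_k(x,x′)| ≤ C e^{−δ₁ r} e^{−δ₀|x − x′|}` for all `x, x′ ∈ Λ₆^{(k−1)′}` (matrix elements of `H_k`, `|x − x′|` = sup-distance of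
the unit labels).  Route = p. 580 «using Proposition I.2.2»: blocks `P×P`, `P×(Λ₃∖Λ₄)`, `(Λ₃∖Λ₄)×P` by (I.2.29) for the pair
`Ω₁ ⊆ Ω`, `P×Λ₄`, `Λ₄×P` by (I.2.27) on `Ω` at separation `≥ r`, `Λ₃×Λ₃` by (I.2.29) for `Ω₂ ⊆ Ω` — (I.2.27)/(I.2.29) at
`A ≠ 0` being p17's `B4Cor23RegularWindow.prop22Small_regularPairW`; constants `C = c₀e^{2δ₀}`, `δ₀/2`, `δ₁ = δ₀/2`.
[cite: Balaban1982Higgs2, (2.109) p.580; Balaban1982Higgs1, Prop. 2.2 (2.27)–(2.29) p.611] -/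
theorem abs_hk_le [Nonempty ι] (F : OrthFlow ι) {ℓ : ℝ} (hℓ : 0 ≤ ℓ)
    (hLip : ∀ t (v : ι → ℝ), ((F.U t - 1) *ᵥ v) ⬝ᵥ ((F.U t - 1) *ᵥ v) ≤ (ℓ * t) ^ 2 * (v ⬝ᵥ v))
    (ham : 0 < aminus) (hle : aminus ≤ aplus) {c : ℝ} (hc : 0 ≤ c) {β : ℝ} (hβ : 0 < β) (M : ℕ) :
    ∃ e₁ C δ₀ δ₁ : ℝ, 0 < e₁ ∧ 0 ≤ C ∧ 0 < δ₀ ∧ 0 < δ₁ ∧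
      ∀ i : Inst d aminus aplus, Adm c β M e₁ i → ∀ p q : ↥i.L6 × ι,
        |i.hk F p q| ≤ C * Real.exp (-(δ₁ * i.r)) * Real.exp (-(δ₀ * supNorm (p.1.1 - q.1.1))) := by
  obtain ⟨δ₀, c₀, e₁, hδ₀, hc₀, he₁, H⟩ := prop22Small_regularPairW (d := d) F hℓ hLip ham hle hc hβ M
  refine ⟨e₁, c₀ * Real.exp (2 * δ₀), δ₀ / 2, δ₀ / 2, he₁, by positivity, by positivity, by positivity, ?_⟩
  intro i hA p q
  -- Proposition I.2.2 on the three region pairs of (2.108)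
  have I0 : B1.Ineq227_229 (regDict F (ham.trans_le i.pair0.hak) c β M i.pair0.toRegularPairInstance).toDelta δ₀ c₀ :=
    H i.pair0 hA.reg ⟨hA.blkΩ, hA.blkΩ⟩ hA.he hA.he1
  have I1 : B1.Ineq227_229 (regDict F (ham.trans_le i.pair1.hak) c β M i.pair1.toRegularPairInstance).toDelta δ₀ c₀ :=
    H i.pair1 hA.reg ⟨hA.blk1, hA.blkΩ⟩ hA.he hA.he1
  have I2 : B1.Ineq227_229 (regDict F (ham.trans_le i.pair2.hak) c β M i.pair2.toRegularPairInstance).toDelta δ₀ c₀ :=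
    H i.pair2 hA.reg ⟨hA.blk2, hA.blkΩ⟩ hA.he hA.he1
  have hD : 0 ≤ supNorm (p.1.1 - q.1.1) := supNorm_nonneg _
  have hrhs := rhs_nonneg (δ₀ := δ₀) (D := supNorm (p.1.1 - q.1.1)) (r := i.r) hc₀.le
  -- the `δΔ(Ω₁ ⊆ Ω)` blocks: both points off `Λ₄^{(k)}` (hence off `Λ₅^{(k)}`)
  have caseΩ1 : ∀ {p q : ↥i.L6 × ι}, p.1.1 ∉ i.L4 → q.1.1 ∉ i.L4 → i.hk F p q = i.DΩ F p q - i.D1 F p q →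
      |i.hk F p q| ≤ c₀ * Real.exp (2 * δ₀) * Real.exp (-(δ₀ / 2 * i.r)) *
        Real.exp (-(δ₀ / 2 * supNorm (p.1.1 - q.1.1))) := by
    intro p q hp4 hq4 hform
    have hp5 : p.1.1 ∉ i.L5 := fun h => hp4 (i.h54 h)
    have hq5 : q.1.1 ∉ i.L5 := fun h => hq4 (i.h54 h)
    rw [hform, DΩ_sub_D1 hp5 hq5, abs_neg]
    by_cases hne : ∃ u ∈ i.Ωc, u ∉ i.Ωc \ i.L5
    · have hsep : ∀ (x : ↥i.L6), x.1 ∉ i.L4 → ∀ u ∈ i.Ωc, u ∉ i.Ωc \ i.L5 → i.r ≤ supNorm (x.1 - u) := by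
        intro x hx u hu hu'
        have hu5 : u ∈ i.L5 := by
          by_contra h5
          exact hu' (Finset.mem_sdiff.2 ⟨hu, h5⟩)
        exact hA.sep45 x.1 x.2 hx u hu5
      have hdp := le_distOc i.pair1.toRegularPairInstance ⟨p.1.1, i.mem_sdiff_of p.1 hp5⟩ hne (hsep p.1 hp4)
      have hdq := le_distOc i.pair1.toRegularPairInstance ⟨q.1.1, i.mem_sdiff_of q.1 hq5⟩ hne (hsep q.1 hq4)
      exact (abs_deltaK_entry_sub_le F _ c β M _ I1 _ _ p.2 q.2).trans
        (damped_le hc₀.le hδ₀.le (supNorm_nonneg _) hA.hr hdp hdq)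
    · -- `Λ₅^{(k)} = ∅`: the localization `Ω₁ = Ω` is void and the block of `H_k` vanishes
      push Not at hne
      have hEq : i.Ωc \ i.L5 = i.Ωc :=
        Finset.Subset.antisymm Finset.sdiff_subset fun u hu => hne u hu
      rw [deltaK_entry_of_eq F i.e i.hn i.ak i.m2 i.Ac _ _ hEq Finset.sdiff_subset, sub_self, abs_zero]
      exact rhs_nonneg hc₀.le
  -- the `Δ(Ω)` blocks at separation `≥ r`
  have caseFar : ∀ {p q : ↥i.L6 × ι}, i.r ≤ supNorm (p.1.1 - q.1.1) → i.hk F p q = i.DΩ F p q →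
      |i.hk F p q| ≤ c₀ * Real.exp (2 * δ₀) * Real.exp (-(δ₀ / 2 * i.r)) *
        Real.exp (-(δ₀ / 2 * supNorm (p.1.1 - q.1.1))) := by
    intro p q hfar hform
    rw [hform, DΩ_eq]
    exact (abs_deltaK_entry_le F _ c β M _ I0 _ _ p.2 q.2).trans (far_le hc₀.le hδ₀.le hfar)
  by_cases hp3 : p.1.1 ∈ i.L3 <;> by_cases hq3 : q.1.1 ∈ i.L3
  · -- `Λ₃ × Λ₃`: `δΔ(Ω₂ ⊆ Ω)`
    rw [hk_33 hp3 hq3, DΩ_sub_D2 hp3 hq3, abs_neg]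
    by_cases hne : ∃ u ∈ i.Ωc, u ∉ i.L2k
    · have hdp := le_distOc i.pair2.toRegularPairInstance ⟨p.1.1, i.h32 hp3⟩ hne
        (fun u hu hu' => hA.sep2k p.1.1 hp3 u hu hu')
      have hdq := le_distOc i.pair2.toRegularPairInstance ⟨q.1.1, i.h32 hq3⟩ hne
        (fun u hu hu' => hA.sep2k q.1.1 hq3 u hu hu')
      exact (abs_deltaK_entry_sub_le F _ c β M _ I2 _ _ p.2 q.2).trans
        (damped_le hc₀.le hδ₀.le hD hA.hr hdp hdq)
    · -- `Λ₂^{(k)} = Λ₂^{(k−1)′}`: the localization `Ω₂ = Ω` is void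
      push Not at hne
      have hEq : i.L2k = i.Ωc := Finset.Subset.antisymm i.h2k fun u hu => hne u hu
      rw [deltaK_entry_of_eq F i.e i.hn i.ak i.m2 i.Ac _ _ hEq i.h2k, sub_self, abs_zero]
      exact hrhs
  · -- `Λ₃ × P`
    by_cases hp4 : p.1.1 ∈ i.L4
    · refine caseFar ?_ (hk_4P hp4 hq3)
      rw [supNorm_sub_comm]
      exact hA.sep34 q.1.1 q.1.2 hq3 p.1.1 hp4
    · exact caseΩ1 hp4 (fun h => hq3 (i.h43 h)) (hk_34P hp3 hp4 hq3)
  · -- `P × Λ₃`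
    by_cases hq4 : q.1.1 ∈ i.L4
    · exact caseFar (hA.sep34 p.1.1 p.1.2 hp3 q.1.1 hq4) (hk_P4 hp3 hq4)
    · exact caseΩ1 (fun h => hp3 (i.h43 h)) hq4 (hk_P34 hp3 hq3 hq4)
  · -- `P × P`
    exact caseΩ1 (fun h => hp3 (i.h43 h)) (fun h => hq3 (i.h43 h)) (hk_PP hp3 hq3)

end Inst

/-! ## §5 The row's decl `B2Sect2Statements.Ineq2109` on the admissible family; r14's twin; the second inequality -/

/-- the admissible steps below the charge threshold `e₁` (the index type of the family). [cite: Balaban1982Higgs2, (2.109) p.580] -/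
def AdmInst (d : ℕ) (aminus aplus c β : ℝ) (M : ℕ) (e₁ : ℝ) : Type :=
  {i : Inst d aminus aplus // Adm c β M e₁ i}

/-- **ROW B2.Eq2.109 — `B2Sect2Statements.Ineq2109` INHABITED** on the family of all admissible steps (index `i` = an
admissible step below the charge threshold; `X i = Λ₆^{(k−1)′} × {1,…,N}`; `h i` = the matrix elements of `H_k`; `dist` = the
sup-distance of the unit labels; `r i` = `r(Lᵏε)`): for some `e₁ > 0`, *"∃ O(1), δ₀, δ₁ > 0: |h_k(x,x′)| ≤
O(1)exp(−δ₁r(Lᵏε))exp(−δ₀|x − x′|) for x, x′ ∈ Λ₆^{(k−1)′}"*. [cite: Balaban1982Higgs2, (2.109) p.580] -/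
theorem ineq2109_regularField [Nonempty ι] (F : OrthFlow ι) {ℓ : ℝ} (hℓ : 0 ≤ ℓ)
    (hLip : ∀ t (v : ι → ℝ), ((F.U t - 1) *ᵥ v) ⬝ᵥ ((F.U t - 1) *ᵥ v) ≤ (ℓ * t) ^ 2 * (v ⬝ᵥ v))
    {aminus aplus : ℝ} (ham : 0 < aminus) (hle : aminus ≤ aplus) {c : ℝ} (hc : 0 ≤ c) {β : ℝ} (hβ : 0 < β) (M : ℕ) :
    ∃ e₁ : ℝ, 0 < e₁ ∧
      B2Sect2Statements.Ineq2109 (fun i : AdmInst d aminus aplus c β M e₁ => ↥i.1.L6 × ι)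
        (fun i p q => i.1.hk F p q) (fun _ p q => supNorm (p.1.1 - q.1.1)) (fun i => i.1.r) := by
  obtain ⟨e₁, C, δ₀, δ₁, he₁, -, hδ₀, hδ₁, h⟩ := Inst.abs_hk_le (d := d) F hℓ hLip ham hle hc hβ M
  exact ⟨e₁, he₁, C, δ₀, δ₁, hδ₀, hδ₁, fun i p q => h i.1 i.2 p q⟩

/-- the same for the ROTATION flow (`N = 2`): every flow hypothesis discharged. [cite: Balaban1982Higgs2, (2.109) p.580] -/
theorem ineq2109_regularField_rot {aminus aplus : ℝ} (ham : 0 < aminus) (hle : aminus ≤ aplus) {c : ℝ} (hc : 0 ≤ c)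
    {β : ℝ} (hβ : 0 < β) (M : ℕ) :
    ∃ e₁ : ℝ, 0 < e₁ ∧
      B2Sect2Statements.Ineq2109 (fun i : AdmInst d aminus aplus c β M e₁ => ↥i.1.L6 × Fin 2)
        (fun i p q => i.1.hk OrthFlow.rot p q) (fun _ p q => supNorm (p.1.1 - q.1.1)) (fun i => i.1.r) :=
  ineq2109_regularField OrthFlow.rot zero_le_one B4Lower18Regular.rot_lipschitz ham hle hc hβ M

/-- the same for the flow `U = e^{tq}` of B4 (1.2), ANY antisymmetric `q` (`N ≥ 1`). [cite: Balaban1982Higgs2, (2.109) p.580] -/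
theorem ineq2109_regularField_exp [Nonempty ι] (qm : Matrix ι ι ℝ) (hq : qmᵀ = -qm) {aminus aplus : ℝ}
    (ham : 0 < aminus) (hle : aminus ≤ aplus) {c : ℝ} (hc : 0 ≤ c) {β : ℝ} (hβ : 0 < β) (M : ℕ) :
    ∃ e₁ : ℝ, 0 < e₁ ∧
      B2Sect2Statements.Ineq2109 (fun i : AdmInst d aminus aplus c β M e₁ => ↥i.1.L6 × ι)
        (fun i p q => i.1.hk (B4Eq12ExpFlow.expFlow qm hq) p q) (fun _ p q => supNorm (p.1.1 - q.1.1))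
        (fun i => i.1.r) :=
  ineq2109_regularField (B4Eq12ExpFlow.expFlow qm hq) (B4Eq12ExpFlow.expFlow_ell_nonneg qm)
    (B4Eq12ExpFlow.expFlow_lipschitz qm hq) ham hle hc hβ M

/-- r14's twin of the first inequality, `B2StepK.KernelBound2109`, for every admissible step, with ONE `(C, δ₁, δ₀)`.
[cite: Balaban1982Higgs2, (2.109) p.580] -/
theorem kernelBound2109_regularField [Nonempty ι] (F : OrthFlow ι) {ℓ : ℝ} (hℓ : 0 ≤ ℓ)
    (hLip : ∀ t (v : ι → ℝ), ((F.U t - 1) *ᵥ v) ⬝ᵥ ((F.U t - 1) *ᵥ v) ≤ (ℓ * t) ^ 2 * (v ⬝ᵥ v))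
    {aminus aplus : ℝ} (ham : 0 < aminus) (hle : aminus ≤ aplus) {c : ℝ} (hc : 0 ≤ c) {β : ℝ} (hβ : 0 < β) (M : ℕ) :
    ∃ e₁ C δ₀ δ₁ : ℝ, 0 < e₁ ∧ 0 ≤ C ∧ 0 < δ₀ ∧ 0 < δ₁ ∧ ∀ i : Inst d aminus aplus, Adm c β M e₁ i →
      B2StepK.KernelBound2109 (i.hk F) (fun p q => supNorm (p.1.1 - q.1.1)) C δ₁ δ₀ i.r := by
  obtain ⟨e₁, C, δ₀, δ₁, he₁, hC, hδ₀, hδ₁, h⟩ := Inst.abs_hk_le (d := d) F hℓ hLip ham hle hc hβ M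
  exact ⟨e₁, C, δ₀, δ₁, he₁, hC, hδ₀, hδ₁, fun i hA p q => h i hA p q⟩

/-- **(2.109), SECOND INEQUALITY** *"≤ O((Lᵏε)^κ)exp(−δ₀|x − x′|) … for … arbitrary κ"* for the concrete `H_k`: when the
instance's `r` is the printed `r(Lᵏε) = R(1 + log(Lᵏε)⁻¹)^r` of (2.7) with the printed ranges (`B2.Params.Printed`) and
`0 < Lᵏε ≤ 1`, then for every `κ`, `|h_k(x,x′)| ≤ C′(Lᵏε)^κ e^{−δ₀|x−x′|}` — by r14's `B2StepK.kernelBound2109_pow_of_printed`.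
[cite: Balaban1982Higgs2, (2.109) p.580, (2.7) p.558] -/
theorem ineq2109_pow_regularField [Nonempty ι] (F : OrthFlow ι) {ℓ : ℝ} (hℓ : 0 ≤ ℓ)
    (hLip : ∀ t (v : ι → ℝ), ((F.U t - 1) *ᵥ v) ⬝ᵥ ((F.U t - 1) *ᵥ v) ≤ (ℓ * t) ^ 2 * (v ⬝ᵥ v))
    {aminus aplus : ℝ} (ham : 0 < aminus) (hle : aminus ≤ aplus) {c : ℝ} (hc : 0 ≤ c) {β : ℝ} (hβ : 0 < β) (M : ℕ)
    (P : B2.Params) (hP : P.Printed) :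
    ∃ e₁ δ₀ : ℝ, 0 < e₁ ∧ 0 < δ₀ ∧ ∀ i : Inst d aminus aplus, Adm c β M e₁ i → ∀ scale : ℝ, 0 < scale → scale ≤ 1 →
      i.r = B2.rFn P.R P.r scale → ∀ κ : ℝ, ∃ C' : ℝ, ∀ p q : ↥i.L6 × ι,
        |i.hk F p q| ≤ C' * scale ^ κ * Real.exp (-(δ₀ * supNorm (p.1.1 - q.1.1))) := by
  obtain ⟨e₁, C, δ₀, δ₁, he₁, hC, hδ₀, hδ₁, h⟩ := kernelBound2109_regularField (d := d) F hℓ hLip ham hle hc hβ M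
  refine ⟨e₁, δ₀, he₁, hδ₀, fun i hA scale hs hs1 hr κ => ?_⟩
  have hk := h i hA
  rw [hr] at hk
  exact B2StepK.kernelBound2109_pow_of_printed P hP hC hδ₁ hk hs hs1 κ

end

end Literature.MathematicalPhysics.QuantumFieldTheory.Balaban1983to89.B2Ineq2109RegularField
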